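import Mathlib
import HarnessLib
import Summits.CriticalPhenomena.PercolationContinuityZ3.Theorems.PercLowPointHalfSpaceBoundaryTwoArmDecayStubCensusTransport

/-!
# Crux `PercLowPointHalfSpace.BoundaryTwoArmDecay` (stmt-CriticalPhenomena-0911), line
# `staircase-bootstrap-floor-decoupling` — stub `stub_census`, part II: the two-anchor transport and the levels

Helper file for the registered stub `stub_census` (TRUNCATED LEVEL CENSUS `P(A_n ∧ K_n ≤ k) ≤ C·k·e_n`) of the
skeleton `Cruxes/BoundaryTwoArmDecay/Lines/staircase_bootstrap_floor_decoupling.lean`; lands with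
`--supports stmt-CriticalPhenomena-0911` (registered sub-goal `stub_census_levelShift`). Definition-free; the
objects are those of `PercLowPointHalfSpaceBoundaryTwoArmDecayStubCensusDefs.lean`.

Write `U = C_ℍ(0)`, `V = C_{ℍ₋₁}(0) ⊇ U`, `J = J n 0 ω` (the number of `n`-tall `ℍ`-clusters inside `V`, as the sum
of `1/|C_ℍ(γ) ∩ ∂ℍ|` over the floor points `γ` of `V` with `C_ℍ(γ)` `n`-tall), `ν_n = nu n`.

* `lintegral_twoAnchor` — the **two-anchor mass transport** (the floor MTP `stub_census_floorMTP` applied to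
  `fTA`): `∫ 1{U n-tall} J⁻¹ |U ∩ ∂ℍ|⁻¹ (|V ∩ ∂ℍ₋₁|⁻¹|V ∩ ∂ℍ₋₁|) dP = ∫ S⁻¹ |V' ∩ ∂ℍ₋₁|⁻¹ S dP`, where on the
  right `V' = C_{ℍ₋₁}(-e₀)` and `S = J n (-e₀) ω` (mass `1/(J |U ∩ ∂ℍ| |V ∩ ∂ℍ₋₁|)` sent from the floor points of
  an `n`-tall `ℍ`-cluster to the level-`(-1)` points of the `ℍ₋₁`-cluster containing it);
* `lintegral_tall_Hm_le` — the right side dominates `∫ 1{V' n-tall}/|V' ∩ ∂ℍ₋₁|` (`S > 0` by the floor root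
  `stub_census_floorRoot`, `S < ∞` by BGN finiteness);
* `stub_census_levelShift` / `lintegral_tall_Hm_eq_nu` — **vertical stationarity**: that density is `ν_{n+1}`
  (the shift by `e₀` preserves `P_{p_c}`, `LowPoint.lintegral_shift`);
* `nu_succ_le_Y` — hence `ν_{n+1} ≤ Y_n := ∫ 1{U n-tall} J⁻¹ |U ∩ ∂ℍ|⁻¹ (|V ∩ ∂ℍ₋₁|⁻¹|V ∩ ∂ℍ₋₁|) dP`, the merger
  input of the level census.

Sources: R. Lyons – Y. Peres, *Probability on Trees and Networks* (2016), §8.2 (mass transport); G. Grimmett,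
*Percolation* (1999), Thm. (7.35) (BGN).
-/

noncomputable section

namespace Summit.CriticalPhenomena.PercolationContinuityZ3.Theorems.BoundaryTwoArmDecay

open MeasureTheory Filter Topology
open Literature.Probability.Percolation Literature.Probability.LatticeModels
open scoped ENNReal

namespace StubCensus

open LowPoint (conn_symm conn_trans conn_refl conn_mono conn_iff_mem_cluster lintegral_shift)
open Negative (μ)

/-! ### The two-anchor transport function: measurability, covariance, marginals -/

/-- `fTA n · a b` is measurable. -/
theorem measurable_fTA (n : ℕ) (a b : Site 3) : Measurable fun ω => fTA n ω a b := by
  have hset : {ω' : BondConfig (Site 3) | a 0 = 0 ∧ b 0 = 0 ∧ ω' ∈ tall (halfSpace 3) n a ∧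
      b - e₀ ∈ cl Hm a ω'} = {_ω | a 0 = 0 ∧ b 0 = 0} ∩ (tall (halfSpace 3) n a ∩
        {ω' | b - e₀ ∈ cl Hm a ω'}) := by
    ext ω
    simp only [Set.mem_setOf_eq, Set.mem_inter_iff]
    tauto
  unfold fTA
  rw [hset]
  refine Measurable.indicator ?_ ((MeasurableSet.const _).inter ((measurableSet_tall _ _ _).inter
    (measurableSet_mem_cl Hm a (b - e₀))))
  exact (measurable_J n a).inv.mul ((measurable_fl_inv _ _ _).mul (measurable_fl_inv _ _ _))

/-- `fTA` is diagonally invariant under horizontal shifts. -/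
theorem fTA_shift (n : ℕ) (ω : BondConfig (Site 3)) (a b v : Site 3) (hv : v 0 = 0) :
    fTA n (BondConfig.relabel (sym2Equiv (Site.shift v)) ω) (a + v) (b + v) = fTA n ω a b := by
  unfold fTA
  have hmem : BondConfig.relabel (sym2Equiv (Site.shift v)) ω ∈ {ω' : BondConfig (Site 3) | (a + v) 0 = 0 ∧
      (b + v) 0 = 0 ∧ ω' ∈ tall (halfSpace 3) n (a + v) ∧ b + v - e₀ ∈ cl Hm (a + v) ω'} ↔
      ω ∈ {ω' : BondConfig (Site 3) | a 0 = 0 ∧ b 0 = 0 ∧ ω' ∈ tall (halfSpace 3) n a ∧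
        b - e₀ ∈ cl Hm a ω'} := by
    simp only [Set.mem_setOf_eq, Pi.add_apply, hv, add_zero, tall_shift_iff hv (add_mem_halfSpace_iff hv)]
    rw [show b + v - e₀ = b - e₀ + v by abel, mem_cl_shift_iff (add_mem_Hm_iff hv)]
  by_cases h : ω ∈ {ω' : BondConfig (Site 3) | a 0 = 0 ∧ b 0 = 0 ∧ ω' ∈ tall (halfSpace 3) n a ∧
      b - e₀ ∈ cl Hm a ω'}
  · rw [Set.indicator_of_mem (hmem.2 h), Set.indicator_of_mem h, J_shift hv,
      fl_shift hv (add_mem_halfSpace_iff hv), fl_shift hv (add_mem_Hm_iff hv)]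
  · rw [Set.indicator_of_notMem (fun h' => h (hmem.1 h')), Set.indicator_of_notMem h]

/-- **Out-mass of the two-anchor transport**: `Σ_{b ∈ ∂ℍ} fTA(ω, 0, b) = 1{U n-tall} J⁻¹ |U ∩ ∂ℍ|⁻¹ (|V ∩ ∂ℍ₋₁|⁻¹ |V ∩ ∂ℍ₋₁|)`
with `V = C_{ℍ₋₁}(0)`. -/
theorem tsum_fTA_left (n : ℕ) (ω : BondConfig (Site 3)) :
    ∑' b, {b : Site 3 | b 0 = 0}.indicator (fTA n ω 0) b =
      (tall (halfSpace 3) n 0).indicator (fun ω => (J n 0 ω)⁻¹ *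
        ((((fl (halfSpace 3) 0 0 ω : ℕ∞) : ℝ≥0∞))⁻¹ * ((((fl Hm (-1) 0 ω : ℕ∞) : ℝ≥0∞))⁻¹ *
          ((fl Hm (-1) 0 ω : ℕ∞) : ℝ≥0∞)))) ω := by
  by_cases ht : ω ∈ tall (halfSpace 3) n 0
  · set c : ℝ≥0∞ := (J n 0 ω)⁻¹ * ((((fl (halfSpace 3) 0 0 ω : ℕ∞) : ℝ≥0∞))⁻¹ *
      (((fl Hm (-1) 0 ω : ℕ∞) : ℝ≥0∞))⁻¹) with hc
    set S : Set (Site 3) := {b | b 0 = 0 ∧ b - e₀ ∈ cl Hm 0 ω} with hS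
    have hterm : ∀ b, {b : Site 3 | b 0 = 0}.indicator (fTA n ω 0) b = S.indicator (fun _ => c) b := by
      intro b
      by_cases hb0 : b 0 = 0
      · rw [Set.indicator_of_mem (show b ∈ {b : Site 3 | b 0 = 0} from hb0)]
        unfold fTA
        by_cases hb : b - e₀ ∈ cl Hm 0 ω
        · rw [Set.indicator_of_mem (show ω ∈ {ω' : BondConfig (Site 3) | (0 : Site 3) 0 = 0 ∧ b 0 = 0 ∧
              ω' ∈ tall (halfSpace 3) n 0 ∧ b - e₀ ∈ cl Hm 0 ω'} from ⟨rfl, hb0, ht, hb⟩),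
            Set.indicator_of_mem (show b ∈ S from ⟨hb0, hb⟩)]
        · rw [Set.indicator_of_notMem (show ω ∉ {ω' : BondConfig (Site 3) | (0 : Site 3) 0 = 0 ∧ b 0 = 0 ∧
              ω' ∈ tall (halfSpace 3) n 0 ∧ b - e₀ ∈ cl Hm 0 ω'} from fun h => hb h.2.2.2),
            Set.indicator_of_notMem (show b ∉ S from fun h => hb h.2)]
      · rw [Set.indicator_of_notMem (show b ∉ {b : Site 3 | b 0 = 0} from hb0),
          Set.indicator_of_notMem (show b ∉ S from fun h => hb0 h.1)]
    have hSenc : S.encard = fl Hm (-1) 0 ω := by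
      rw [fl]
      have hS' : S = (· + e₀) '' (cl Hm 0 ω ∩ {u | u 0 = -1}) := by
        ext b
        constructor
        · rintro ⟨hb0, hb⟩
          refine ⟨b - e₀, ⟨hb, ?_⟩, sub_add_cancel b e₀⟩
          show (b - e₀) 0 = -1
          simp [e₀, hb0]
        · rintro ⟨u, ⟨hu, hu0⟩, rfl⟩
          have hu0' : u 0 = -1 := hu0
          refine ⟨?_, ?_⟩
          · show (u + e₀) 0 = 0
            simp [e₀, hu0']
          · show u + e₀ - e₀ ∈ cl Hm 0 ω
            rwa [add_sub_cancel_right]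
      rw [hS', (add_left_injective e₀).injOn.encard_image]
    rw [tsum_congr hterm, ← tsum_subtype, ENNReal.tsum_set_const, Set.indicator_of_mem ht, hSenc, hc]
    ring
  · rw [Set.indicator_of_notMem ht]
    refine ENNReal.tsum_eq_zero.2 fun b => ?_
    by_cases hb0 : b 0 = 0
    · rw [Set.indicator_of_mem (show b ∈ {b : Site 3 | b 0 = 0} from hb0)]
      unfold fTA
      exact Set.indicator_of_notMem (fun h => ht h.2.2.1) _
    · exact Set.indicator_of_notMem (show b ∉ {b : Site 3 | b 0 = 0} from hb0) _

/-- **In-mass of the two-anchor transport**: `Σ_{a ∈ ∂ℍ} fTA(ω, a, 0) = S⁻¹ (|V' ∩ ∂ℍ₋₁|⁻¹ S)` with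
`V' = C_{ℍ₋₁}(-e₀)` and `S = J n (-e₀) ω`. -/
theorem tsum_fTA_right (n : ℕ) (ω : BondConfig (Site 3)) :
    ∑' a, {a : Site 3 | a 0 = 0}.indicator (fun a => fTA n ω a 0) a =
      (J n (-e₀) ω)⁻¹ * ((((fl Hm (-1) (-e₀) ω : ℕ∞) : ℝ≥0∞))⁻¹ * J n (-e₀) ω) := by
  set S : ℝ≥0∞ := J n (-e₀) ω with hSdef
  set Φ : ℝ≥0∞ := (((fl Hm (-1) (-e₀) ω : ℕ∞) : ℝ≥0∞))⁻¹ with hΦ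
  have hterm : ∀ a, {a : Site 3 | a 0 = 0}.indicator (fun a => fTA n ω a 0) a =
      {γ : Site 3 | γ 0 = 0 ∧ γ ∈ cl Hm (-e₀) ω ∧ ω ∈ tall (halfSpace 3) n γ}.indicator
        (fun γ => S⁻¹ * Φ * (((fl (halfSpace 3) 0 γ ω : ℕ∞) : ℝ≥0∞))⁻¹) a := by
    intro a
    by_cases ha0 : a 0 = 0
    · rw [Set.indicator_of_mem (show a ∈ {a : Site 3 | a 0 = 0} from ha0)]
      unfold fTA
      by_cases h : ω ∈ tall (halfSpace 3) n a ∧ (0 : Site 3) - e₀ ∈ cl Hm a ω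
      · have ha : a ∈ cl Hm (-e₀) ω := by
          have h2 := h.2
          rw [zero_sub] at h2
          exact conn_symm h2
        rw [Set.indicator_of_mem (show ω ∈ {ω' : BondConfig (Site 3) | a 0 = 0 ∧ (0 : Site 3) 0 = 0 ∧
            ω' ∈ tall (halfSpace 3) n a ∧ 0 - e₀ ∈ cl Hm a ω'} from ⟨ha0, rfl, h.1, h.2⟩),
          Set.indicator_of_mem (show a ∈ {γ : Site 3 | γ 0 = 0 ∧ γ ∈ cl Hm (-e₀) ω ∧
            ω ∈ tall (halfSpace 3) n γ} from ⟨ha0, ha, h.1⟩), J_eq_of_mem ha, fl_eq_of_mem ha]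
        simp only [hSdef, hΦ]
        ring
      · rw [Set.indicator_of_notMem (show ω ∉ {ω' : BondConfig (Site 3) | a 0 = 0 ∧ (0 : Site 3) 0 = 0 ∧
            ω' ∈ tall (halfSpace 3) n a ∧ 0 - e₀ ∈ cl Hm a ω'} from fun h' => h ⟨h'.2.2.1, h'.2.2.2⟩),
          Set.indicator_of_notMem]
        rintro ⟨-, ha, hta⟩
        refine h ⟨hta, ?_⟩
        rw [zero_sub]
        exact conn_symm ha
    · rw [Set.indicator_of_notMem (show a ∉ {a : Site 3 | a 0 = 0} from ha0),
        Set.indicator_of_notMem (fun h => ha0 h.1)]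
  rw [tsum_congr hterm]
  have hmul : ∀ a, {γ : Site 3 | γ 0 = 0 ∧ γ ∈ cl Hm (-e₀) ω ∧ ω ∈ tall (halfSpace 3) n γ}.indicator
      (fun γ => S⁻¹ * Φ * (((fl (halfSpace 3) 0 γ ω : ℕ∞) : ℝ≥0∞))⁻¹) a =
      S⁻¹ * Φ * {γ : Site 3 | γ 0 = 0 ∧ γ ∈ cl Hm (-e₀) ω ∧ ω ∈ tall (halfSpace 3) n γ}.indicator
        (fun γ => (((fl (halfSpace 3) 0 γ ω : ℕ∞) : ℝ≥0∞))⁻¹) a := fun a =>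
    Set.indicator_mul_right _ (fun _ => S⁻¹ * Φ) _
  rw [tsum_congr hmul, ENNReal.tsum_mul_left]
  rw [show (∑' γ, {γ : Site 3 | γ 0 = 0 ∧ γ ∈ cl Hm (-e₀) ω ∧ ω ∈ tall (halfSpace 3) n γ}.indicator
    (fun γ => (((fl (halfSpace 3) 0 γ ω : ℕ∞) : ℝ≥0∞))⁻¹) γ) = S from rfl]
  ring

/-- **The two-anchor transport identity** (mass transport with `fTA`). -/
theorem lintegral_twoAnchor (n : ℕ) :
    ∫⁻ ω, (tall (halfSpace 3) n 0).indicator (fun ω => (J n 0 ω)⁻¹ *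
        ((((fl (halfSpace 3) 0 0 ω : ℕ∞) : ℝ≥0∞))⁻¹ * ((((fl Hm (-1) 0 ω : ℕ∞) : ℝ≥0∞))⁻¹ *
          ((fl Hm (-1) 0 ω : ℕ∞) : ℝ≥0∞)))) ω ∂μ =
      ∫⁻ ω, (J n (-e₀) ω)⁻¹ * ((((fl Hm (-1) (-e₀) ω : ℕ∞) : ℝ≥0∞))⁻¹ * J n (-e₀) ω) ∂μ := by
  have h := stub_census_floorMTP (criticalProbI 3) (fTA n) (fun a b => measurable_fTA n a b)
    (fun ω a b v hv => fTA_shift n ω a b v hv)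
  calc ∫⁻ ω, (tall (halfSpace 3) n 0).indicator (fun ω => (J n 0 ω)⁻¹ *
        ((((fl (halfSpace 3) 0 0 ω : ℕ∞) : ℝ≥0∞))⁻¹ * ((((fl Hm (-1) 0 ω : ℕ∞) : ℝ≥0∞))⁻¹ *
          ((fl Hm (-1) 0 ω : ℕ∞) : ℝ≥0∞)))) ω ∂μ
      = ∫⁻ ω, ∑' b, {b : Site 3 | b 0 = 0}.indicator (fTA n ω 0) b ∂μ :=
        lintegral_congr fun ω => (tsum_fTA_left n ω).symm
    _ = ∫⁻ ω, ∑' a, {a : Site 3 | a 0 = 0}.indicator (fun a => fTA n ω a 0) a ∂μ := h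
    _ = _ := lintegral_congr fun ω => tsum_fTA_right n ω

/-! ### Bounds on `J` -/

/-- A floor point has a footed `ℍ`-cluster: `1 ≤ |C_ℍ(γ) ∩ ∂ℍ|`. -/
theorem one_le_fl {γ : Site 3} (hγ : γ 0 = 0) (ω : BondConfig (Site 3)) :
    (1 : ℝ≥0∞) ≤ ((fl (halfSpace 3) 0 γ ω : ℕ∞) : ℝ≥0∞) := by
  rw [← ENat.toENNReal_one, ENat.toENNReal_le, fl, Set.one_le_encard_iff_nonempty]
  refine ⟨γ, self_mem_cl ?_ ω, hγ⟩
  show 0 ≤ γ 0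
  omega

/-- `J n a ω ≤ |C_{ℍ₋₁}(a)|`. -/
theorem J_le_encard (n : ℕ) (a : Site 3) (ω : BondConfig (Site 3)) :
    J n a ω ≤ (((cl Hm a ω).encard : ℕ∞) : ℝ≥0∞) := by
  have h1 : (((cl Hm a ω).encard : ℕ∞) : ℝ≥0∞) = ∑' γ, (cl Hm a ω).indicator (fun _ => (1 : ℝ≥0∞)) γ := by
    rw [← ENNReal.tsum_set_one]
    exact tsum_subtype (cl Hm a ω) (fun _ => (1 : ℝ≥0∞))
  rw [h1, J]
  refine ENNReal.tsum_le_tsum fun γ => ?_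
  by_cases hγ : γ ∈ {γ : Site 3 | γ 0 = 0 ∧ γ ∈ cl Hm a ω ∧ ω ∈ tall (halfSpace 3) n γ}
  · rw [Set.indicator_of_mem hγ, Set.indicator_of_mem hγ.2.1]
    exact ENNReal.inv_le_one.2 (one_le_fl hγ.1 ω)
  · rw [Set.indicator_of_notMem hγ]
    exact bot_le

/-- On the good event, `J n a ω < ∞` for `a` of level `-1`. -/
theorem J_lt_top {ω : BondConfig (Site 3)}
    (hfin : ∀ v : Site 3, (halfSpaceCluster (BondConfig.relabel (sym2Equiv (Site.shift v)) ω)).Finite)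
    (n : ℕ) {a : Site 3} (ha : a 0 = -1) : J n a ω < ⊤ :=
  lt_of_le_of_lt (J_le_encard n a ω) (ENat.toENNReal_lt_top.2 (finite_cl_Hm hfin ha).encard_lt_top)

/-- On the good event, if `C_{ℍ₋₁}(-e₀)` meets level `n ≥ 0` then `J n (-e₀) ω ≠ 0` (the floor root of a tall
vertex contributes a positive term). -/
theorem J_ne_zero {ω : BondConfig (Site 3)} (hE : ω ⊆ (zdGraph 3).edgeSet)
    (hfin : ∀ v : Site 3, (halfSpaceCluster (BondConfig.relabel (sym2Equiv (Site.shift v)) ω)).Finite)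
    {n : ℕ} (ht : ω ∈ tall Hm n (-e₀)) : J n (-e₀) ω ≠ 0 := by
  obtain ⟨y, hy, hcy⟩ := ht
  obtain ⟨c, hc0, hc, hcy'⟩ := exists_floor_root hE hcy (le_trans (Int.natCast_nonneg n) hy)
  intro hJ
  rw [J, ENNReal.tsum_eq_zero] at hJ
  have h := hJ c
  rw [Set.indicator_of_mem (show c ∈ {γ : Site 3 | γ 0 = 0 ∧ γ ∈ cl Hm (-e₀) ω ∧
      ω ∈ tall (halfSpace 3) n γ} from ⟨hc0, hc, y, hy, hcy'⟩), ENNReal.inv_eq_zero,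
    ENat.toENNReal_eq_top] at h
  exact ((finite_cl_halfSpace hfin hc0).subset Set.inter_subset_left).encard_lt_top.ne h

/-- The in-mass dominates the density of `n`-tall footed `ℍ₋₁`-clusters:
`∫ 1{C_{ℍ₋₁}(-e₀) n-tall}/|… ∩ ∂ℍ₋₁| ≤ ∫ S⁻¹ |… ∩ ∂ℍ₋₁|⁻¹ S`. -/
theorem lintegral_tall_Hm_le (n : ℕ) :
    ∫⁻ ω, (tall Hm n (-e₀)).indicator (fun ω => (((fl Hm (-1) (-e₀) ω : ℕ∞) : ℝ≥0∞))⁻¹) ω ∂μ ≤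
      ∫⁻ ω, (J n (-e₀) ω)⁻¹ * ((((fl Hm (-1) (-e₀) ω : ℕ∞) : ℝ≥0∞))⁻¹ * J n (-e₀) ω) ∂μ := by
  refine lintegral_mono_ae ?_
  filter_upwards [ae_good] with ω hω
  by_cases ht : ω ∈ tall Hm n (-e₀)
  · rw [Set.indicator_of_mem ht]
    have h0 := J_ne_zero hω.1 hω.2 ht
    have htop := (J_lt_top hω.2 n (show (-e₀) 0 = -1 by simp [e₀])).ne
    rw [mul_comm, mul_assoc, ENNReal.mul_inv_cancel h0 htop, mul_one]
  · rw [Set.indicator_of_notMem ht]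
    exact bot_le

/-! ### The vertical shift: `ℍ₋₁`-clusters of `-e₀` are `ℍ`-clusters of `0` one level down -/

/-- Reading the `ℍ₋₁`-cluster of `-e₀` in the configuration shifted down by `e₀`. -/
theorem shift_conn_Hm_iff (ω : BondConfig (Site 3)) (u : Site 3) :
    BondConfig.relabel (sym2Equiv (Site.shift (-e₀))) ω ∈ openConnIn Hm (-e₀) u ↔
      ω ∈ openConnIn (halfSpace 3) 0 (u + e₀) := by
  rw [show Hm = {x : Site 3 | (-1 : ℤ) ≤ x 0} from rfl, LowPoint.shift_mem_openConnIn_iff_sub,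
    LowPoint.preimage_add_level, sub_self, sub_neg_eq_add, halfSpace_eq]
  simp [e₀]

/-- **Vertical stationarity**: the density of `n`-tall footed `ℍ₋₁`-clusters (anchored at `-e₀`) equals
`ν_{n+1}`. -/
theorem lintegral_tall_Hm_eq_nu (n : ℕ) :
    ∫⁻ ω, (tall Hm n (-e₀)).indicator (fun ω => (((fl Hm (-1) (-e₀) ω : ℕ∞) : ℝ≥0∞))⁻¹) ω ∂μ =
      nu (n + 1) := by
  rw [nu, ← lintegral_shift (-e₀) (criticalProbI 3) (fun ω => (tall Hm n (-e₀)).indicator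
    (fun ω => (((fl Hm (-1) (-e₀) ω : ℕ∞) : ℝ≥0∞))⁻¹) ω)]
  refine lintegral_congr fun ω => ?_
  have hfl : fl Hm (-1) (-e₀) (BondConfig.relabel (sym2Equiv (Site.shift (-e₀))) ω) = fl (halfSpace 3) 0 0 ω := by
    rw [fl, fl]
    have hset : cl Hm (-e₀) (BondConfig.relabel (sym2Equiv (Site.shift (-e₀))) ω) ∩ {u | u 0 = -1} =
        (fun u : Site 3 => u - e₀) '' (cl (halfSpace 3) 0 ω ∩ {u | u 0 = 0}) := by
      ext u
      simp only [Set.mem_inter_iff, mem_cl, shift_conn_Hm_iff, Set.mem_image, Set.mem_setOf_eq]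
      constructor
      · rintro ⟨h1, h2⟩
        exact ⟨u + e₀, ⟨h1, by simp [e₀, h2]⟩, add_sub_cancel_right u e₀⟩
      · rintro ⟨w, ⟨h1, h2⟩, rfl⟩
        exact ⟨by rwa [sub_add_cancel], by simp [e₀, h2]⟩
    rw [hset, sub_left_injective.injOn.encard_image]
  have htall : BondConfig.relabel (sym2Equiv (Site.shift (-e₀))) ω ∈ tall Hm n (-e₀) ↔
      ω ∈ tall (halfSpace 3) (n + 1) 0 := by
    simp only [mem_tall, shift_conn_Hm_iff]
    constructor
    · rintro ⟨y, hy, h⟩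
      refine ⟨y + e₀, ?_, h⟩
      simp only [Pi.add_apply, e₀, Pi.single_eq_same]
      push_cast
      omega
    · rintro ⟨y, hy, h⟩
      refine ⟨y - e₀, ?_, by rwa [sub_add_cancel]⟩
      simp only [Pi.sub_apply, e₀, Pi.single_eq_same]
      push_cast at hy
      omega
  by_cases ht : ω ∈ tall (halfSpace 3) (n + 1) 0
  · rw [Set.indicator_of_mem (htall.2 ht), Set.indicator_of_mem ht, hfl]
  · rw [Set.indicator_of_notMem (fun h => ht (htall.1 h)), Set.indicator_of_notMem ht]

/-- **The merger input**: `ν_{n+1} ≤ Y_n := ∫ 1{U n-tall} J⁻¹ |U ∩ ∂ℍ|⁻¹ (|V ∩ ∂ℍ₋₁|⁻¹ |V ∩ ∂ℍ₋₁|)`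
(`V = C_{ℍ₋₁}(0)`): vertical stationarity, the floor root, and the two-anchor transport. -/
theorem nu_succ_le_Y (n : ℕ) :
    nu (n + 1) ≤ ∫⁻ ω, (tall (halfSpace 3) n 0).indicator (fun ω => (J n 0 ω)⁻¹ *
        ((((fl (halfSpace 3) 0 0 ω : ℕ∞) : ℝ≥0∞))⁻¹ * ((((fl Hm (-1) 0 ω : ℕ∞) : ℝ≥0∞))⁻¹ *
          ((fl Hm (-1) 0 ω : ℕ∞) : ℝ≥0∞)))) ω ∂μ := by
  rw [← lintegral_tall_Hm_eq_nu, lintegral_twoAnchor]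
  exact lintegral_tall_Hm_le n

end StubCensus

/-- **Vertical stationarity of the level census** (registered sub-goal `stub_census_levelShift` of
`stub_census`): at `p_c(ℤ³)`, the density per floor site of `ℍ₋₁`-clusters footed at level `-1` and meeting
level `n` (anchored at `-e₀ = (-1,0,0)`, weight `1/|cluster ∩ {x₀ = -1}|`) equals the density `ν_{n+1}` of
`ℍ`-clusters footed at level `0` meeting level `n + 1` (the shift by `e₀` preserves `P_{p_c}`). -/
theorem stub_census_levelShift : ∀ n : ℕ,
    ∫⁻ ω, {ω : BondConfig (Site 3) | ∃ y : Site 3, (n : ℤ) ≤ y 0 ∧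
        ω ∈ openConnIn {x : Site 3 | -1 ≤ x 0} (-(Pi.single 0 1)) y}.indicator
      (fun ω => (((({u : Site 3 | ω ∈ openConnIn {x : Site 3 | -1 ≤ x 0} (-(Pi.single 0 1)) u} ∩
        {u : Site 3 | u 0 = -1}).encard : ℕ∞) : ENNReal))⁻¹) ω ∂(bondPercolation (zdGraph 3) (criticalProbI 3)) =
    ∫⁻ ω, {ω : BondConfig (Site 3) | ∃ y : Site 3, ((n + 1 : ℕ) : ℤ) ≤ y 0 ∧
        ω ∈ openConnIn (halfSpace 3) 0 y}.indicator
      (fun ω => (((halfSpaceFootprint ω : ℕ∞) : ENNReal))⁻¹) ω ∂(bondPercolation (zdGraph 3) (criticalProbI 3)) :=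
  fun n => StubCensus.lintegral_tall_Hm_eq_nu n

end Summit.CriticalPhenomena.PercolationContinuityZ3.Theorems.BoundaryTwoArmDecay

end
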